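import Literature.Geometry.Kaehler.ChartWindowCore
import Literature.Geometry.Kaehler.ChartWindowLipschitz
import Literature.Geometry.Kaehler.LelongVolumeLowerBound
import Literature.Geometry.GeometricMeasureTheory.MassFormula
import Literature.Geometry.GeometricMeasureTheory.FlatComplete
import HarnessLib

/-!
# The blow-ups converge to a multiple of the graph over the core of a chart window

Continuing `ChartWindowCore.lean`: let `T` be a holomorphic `p`-chain (`p = q + 1`), `b` a base
point with `𝐁(b, r₀) ⊆ Ω`, `D_r = (1/r)_*(τ_{-b})_*[T]` the blow-ups and `W` a chart window (closed
tube in `𝐁(0, ρ₀)`, `ρ₀ < 1`, chart with `‖DΨ‖ ≤ M`, `τ ≤ (a₁² − a₂²)/(2ρ)`) such that the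
pulled-back carriers are vertically `τ/16`-close to the graph in the tube for `0 < r < r₀`, with
sheet number `c` (`HolomorphicChain.exists_sheetNumber`). The collapse `h` of the window retracts
the core piece `P_r = D_r ⌞ innerCore` onto `c` times the graph current `[Γ]`
(`HolomorphicChain.collapse_pushforward_corePiece`: `h_# P_r = c · [Γ]`). Here we run the affine
homotopy from `id` to `h` [Federer1969, 4.1.9]:

* `HolomorphicChain.support_boundary_corePiece_subset` — `spt ∂P_r ⊆ {‖k‖ = a₃}` (the core piece
  is a cycle inside the inner core, and carries nothing near its top and bottom);
* `HolomorphicChain.rim_corePiece_apply_eq_zero` — the rim term `H_#([0,1] × ∂P_r)` of the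
  homotopy formula kills every form supported in the inner core (`k ∘ H_t = k`);
* `HolomorphicChain.smul_graphCurrent_sub_corePiece_eq` — **`c · [Γ] − P_r = ∂ S_r + rim`**,
  `S_r = H_#([0,1] × P_r)`, hence `c · [Γ](ψ) − P_r(ψ) = S_r(dψ)` for `spt ψ ⊆ innerCore`
  (`HolomorphicChain.smul_graphCurrent_sub_corePiece_apply`);
* `HolomorphicChain.mass_homotopy_corePiece_le` — **`𝐌(S_r) ≤ 2η (1 + t₀(L₀ + 1))^{2p} 𝐌(P_r)`**
  as soon as the carrier is vertically `η`-close to the graph in the tube (the homotopy moves points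
  by `‖h x − x‖ ≤ ‖w x‖`; `L₀` the absolute Lipschitz bound of `ChartWindowLipschitz.lean`; the
  cutoff is adapted to `spt P_r`, on which the push-forward does not depend);
* `HolomorphicChain.tendsto_corePiece_apply` — consequently, if the carrier is eventually
  vertically `η`-close for EVERY `η > 0` (the windows of the tangent cone,
  `LimitConeWindows.lean`), then **`D_r(ψ) → c · [Γ](ψ)` as `r → 0⁺` for every test form `ψ`
  supported in the inner core** (`HolomorphicChain.tendsto_blowUp_apply_of_tsupport_subset_innerCore`
  for forms on the unit ball): the blow-ups converge weakly, over the core of the window, to the sheet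
  number times the tangent cone — the local form, at the regular directions of the cone, of King's
  tangent cone theorem (`Literature.Geometry.Kaehler.King1971_tangentCone`, [Harvey1977, Thm. 1.31];
  [Federer1969, 4.3.18]), with the FULL limit `r → 0⁺` and no subsequences.

Theorems only; no definitions, no named facts.

## References

* H. Federer, *Geometric Measure Theory*, Springer 1969, 4.1.7, 4.1.9, 4.3.16–4.3.18 [Federer1969].
* R. Harvey, *Holomorphic chains and their boundaries*, PSPUM XXX.1 (1977), §1.10, Thm. 1.31
  [Harvey1977].
* J. R. King, *The currents defined by analytic varieties*, Acta Math. 127 (1971), §5.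
-/

noncomputable section

open scoped Manifold Topology ENNReal NNReal InnerProductSpace ContDiff Distributions
open Set Filter MeasureTheory Metric Function Module TopologicalSpace

namespace Literature.Geometry.Kaehler

open Literature.Geometry.GeometricMeasureTheory

-- Nested operator-norm instances on (duals of) `V [⋀^Fin n]→L[ℝ] ℝ`.
set_option maxSynthPendingDepth 2

universe u

variable {V : Type u} [NormedAddCommGroup V] [InnerProductSpace ℂ V] [FiniteDimensional ℂ V]

/-! ### Private helpers -/

/-- A cutoff `= 1` near a compact `K`, with `|χ| ≤ 1` and support inside a prescribed open `N ⊇ K`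
(a private copy of `exists_testFunction_eq_one_nhds_subset`). [folklore] -/
private theorem exists_cutoff_subset {E : Type*} [NormedAddCommGroup E] [NormedSpace ℝ E]
    [FiniteDimensional ℝ E] {Ω : Opens E} {K N : Set E} (hK : IsCompact K) (hN : IsOpen N)
    (hKΩ : K ⊆ (Ω : Set E)) (hKN : K ⊆ N) :
    ∃ (χ : 𝓓(Ω, ℝ)) (U : Set E), IsOpen U ∧ K ⊆ U ∧ (∀ x ∈ U, χ x = 1) ∧ (∀ x, |χ x| ≤ 1) ∧
      tsupport ⇑χ ⊆ N := by
  obtain ⟨χ', U, hU, hKU, h1, h01⟩ := exists_testFunction_eq_one_nhds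
    (Ω := ⟨(Ω : Set E) ∩ N, Ω.isOpen.inter hN⟩) hK (subset_inter hKΩ hKN)
  refine ⟨⟨χ', χ'.contDiff, χ'.hasCompactSupport, (χ'.tsupport_subset).trans inter_subset_left⟩,
    U, hU, hKU, h1, fun x => ?_, (χ'.tsupport_subset).trans inter_subset_right⟩
  have := h01 x
  show |χ' x| ≤ 1
  rw [abs_le]; constructor <;> linarith [this.1, this.2]

/-- `spt T ∩ W = ∅` when `T` kills every form supported in the open set `W`. [folklore] -/
private theorem support_inter_eq_empty_of_forall {E : Type*} [NormedAddCommGroup E]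
    [NormedSpace ℝ E] {Ω : Opens E} {m : ℕ} (T : Current Ω m) {W : Set E} (hW : IsOpen W)
    (h : ∀ φ : TestForm Ω m, tsupport ⇑φ ⊆ W → T φ = 0) : T.support ∩ W = ∅ := by
  ext x
  simp only [mem_inter_iff, mem_empty_iff_false, iff_false, not_and]
  intro hx hxW
  obtain ⟨φ, hφ, hφT⟩ := hx.2 W (hW.mem_nhds hxW)
  exact hφT (h φ hφ)

/-- `|T(ψ)| ≤ C · 𝐌(T)` for `‖ψ‖ ≤ C` and `𝐌(T) < ∞`. [cite: Federer1969, 4.1.7] -/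
private theorem abs_apply_le_mul_mass {E : Type*} [NormedAddCommGroup E] [NormedSpace ℝ E]
    {Ω : Opens E} {m : ℕ} (T : Current Ω m) (hT : T.mass ≠ ⊤) {ψ : TestForm Ω m} {C : ℝ}
    (hC : 0 < C) (hψ : ∀ x, ‖ψ x‖ ≤ C) : |T ψ| ≤ C * T.mass.toReal := by
  have key : ∀ φ : TestForm Ω m, (∀ x, ‖φ x‖ ≤ C) → T φ ≤ C * T.mass.toReal := by
    intro φ hφ
    have h1 : ∀ x, ‖(C⁻¹ • φ) x‖ ≤ 1 := fun x => by
      change ‖C⁻¹ • φ x‖ ≤ 1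
      rw [norm_smul, Real.norm_of_nonneg (inv_nonneg.2 hC.le)]
      calc C⁻¹ * ‖φ x‖ ≤ C⁻¹ * C := by gcongr; exact hφ x
        _ = 1 := inv_mul_cancel₀ hC.ne'
    have h2 := T.ofReal_apply_le_mass h1
    rw [map_smul, smul_eq_mul] at h2
    have h3 : C⁻¹ * T φ ≤ T.mass.toReal := by
      by_cases hle : C⁻¹ * T φ ≤ 0
      · exact hle.trans ENNReal.toReal_nonneg
      · exact (ENNReal.ofReal_le_iff_le_toReal hT).1 h2
    calc T φ = C * (C⁻¹ * T φ) := by field_simp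
      _ ≤ C * T.mass.toReal := by gcongr
  rcases le_or_gt 0 (T ψ) with h | h
  · rw [abs_of_nonneg h]; exact key ψ hψ
  · rw [abs_of_neg h, ← map_neg]
    exact key (-ψ) fun x => by change ‖-ψ x‖ ≤ C; rw [norm_neg]; exact hψ x

namespace ChartWindow

variable (W : ChartWindow V)

/-- `{‖k‖ < s, ‖w‖ < η}` is open for `s ≤ ρ`. [folklore] -/
private theorem isOpen_norm_kf_lt_inter_norm_wf_lt {s η : ℝ} (hs : s ≤ W.ρ) :
    IsOpen {x : V | ‖W.kf x‖ < s ∧ ‖W.wf x‖ < η} := by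
  have h1 : IsOpen {x : V | ‖W.kf x‖ < s} :=
    isOpen_lt (continuous_norm.comp W.contDiff_kf.continuous) continuous_const
  have h2 : IsOpen ({x : V | ‖W.kf x‖ < W.ρ} ∩ W.wf ⁻¹' ball (0 : V) η) :=
    W.contDiffOn_wf.continuousOn.isOpen_inter_preimage W.isOpen_chartDomain isOpen_ball
  have : {x : V | ‖W.kf x‖ < s ∧ ‖W.wf x‖ < η} =
      {x : V | ‖W.kf x‖ < s} ∩ ({x : V | ‖W.kf x‖ < W.ρ} ∩ W.wf ⁻¹' ball (0 : V) η) := by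
    ext x
    simp only [mem_setOf_eq, mem_inter_iff, mem_preimage, mem_ball_zero_iff]
    exact ⟨fun h => ⟨h.1, h.1.trans_le hs, h.2⟩, fun h => ⟨h.1, h.2.2⟩⟩
  rw [this]
  exact h1.inter h2

/-- **`k` is constant along the homotopy from `id` to the collapse**: `k(x + t(h x − x)) = k(x)`
(`k` is affine and `k ∘ h = k`). [cite: Federer1969, 4.3.18] -/
theorem kf_affineHomotopy_collapse (p : ℝ × V) :
    W.kf (affineHomotopy id W.collapse p) = W.kf p.2 := by
  have h1 : W.K.orthogonalProjectionOnto (W.collapse p.2 - p.2) = 0 := by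
    have := W.kf_collapse p.2
    simp only [ChartWindow.kf] at this
    rw [show W.collapse p.2 - p.2 = (W.collapse p.2 - W.m) - (p.2 - W.m) by abel, map_sub, this,
      sub_self]
  simp only [affineHomotopy, id, ChartWindow.kf]
  rw [show p.2 + p.1 • (W.collapse p.2 - p.2) - W.m = (p.2 - W.m) + p.1 • (W.collapse p.2 - p.2)
    by abel, map_add, ← Complex.coe_smul, map_smul, h1, smul_zero, add_zero]

end ChartWindow

/-! ### The homotopy formula over a chart window -/

namespace HolomorphicChain

variable [MeasurableSpace V] [BorelSpace V] {Ω : Opens V} {q : ℕ}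

variable (T : HolomorphicChain 𝓘(ℂ, V) Ω (q + 1)) {b : V} {r₀ : ℝ} (hr₀ : 0 < r₀)
  (hΩ : closedBall b r₀ ⊆ (Ω : Set V)) (W : ChartWindow V) (hKp : finrank ℂ W.K = q + 1) {ρ₀ : ℝ}
  (hρ₀ : ρ₀ < 1) (hW : W.closedTube ⊆ closedBall (0 : V) ρ₀)
  (htube : ∀ r ∈ Ioo 0 r₀, T.blowUpSet b r ∩ W.closedTube ⊆ {x | ‖W.wf x‖ < W.τ / 16})

omit [InnerProductSpace ℂ V] [FiniteDimensional ℂ V] [MeasurableSpace V] [BorelSpace V] in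
/-- `B(b, r) ⊆ Ω` for `r < r₀` when `𝐁(b, r₀) ⊆ Ω`. [folklore] -/
private theorem ball_subset_of_mem_Ioo {b : V} {r₀ r : ℝ} (hΩ : closedBall b r₀ ⊆ (Ω : Set V))
    (hr : r ∈ Ioo 0 r₀) : ball b r ⊆ (Ω : Set V) :=
  (ball_subset_closedBall.trans (closedBall_subset_closedBall hr.2.le)).trans hΩ

include hΩ hρ₀ hW htube in
/-- **The boundary of the core piece lives on the lateral face `{‖k‖ = a₃}`**: `P_r` is a cycle
inside the open inner core (`boundary_blowUpPiece_apply_eq_zero`), and its support lies in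
`{‖k‖ ≤ a₃, ‖w‖ ≤ τ/16}`. [cite: Federer1969, 4.1.7, 4.3.16] -/
theorem support_boundary_corePiece_subset {r : ℝ} (hr : r ∈ Ioo 0 r₀) :
    (T.corePiece b r W).boundary.support ⊆ {x | ‖W.kf x‖ = W.a₃} := by
  intro x hx
  have hxP := (T.corePiece b r W).support_boundary_subset hx
  have h1 := support_corePiece_subset T W (htube r hr) hxP
  -- `spt ∂P ∩ innerCore = ∅`
  have h2 : (T.corePiece b r W).boundary.support ∩ W.innerCore = ∅ :=
    support_inter_eq_empty_of_forall _ W.isOpen_innerCore fun φ hφ =>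
      T.boundary_blowUpPiece_apply_eq_zero hr.1 (ball_subset_of_mem_Ioo hΩ hr)
        W.isOpen_innerCore.measurableSet hρ₀ (innerCore_subset_closedBall W hW) (subset_refl _) φ hφ
  have hxI : x ∉ W.innerCore := fun h => by
    have : x ∈ (T.corePiece b r W).boundary.support ∩ W.innerCore := ⟨hx, h⟩
    rw [h2] at this
    exact this
  refine le_antisymm h1.1 (not_lt.1 fun hlt => hxI ⟨hlt, ?_⟩)
  exact lt_of_le_of_lt h1.2 (by linarith [W.τ_pos])

include hΩ hρ₀ hW htube in
/-- **The rim term of the homotopy formula kills forms supported in the inner core.** With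
`H(t, x) = x + t (h x − x)` the affine homotopy from `id` to the collapse `h`, the current
`H_#([0,1] × ∂P_r)` is supported in `H([0,1] × spt ∂P_r) ⊆ {‖k‖ = a₃}` (`k ∘ H_t = k`,
`spt ∂P_r ⊆ {‖k‖ = a₃}`), which misses the inner core. [cite: Federer1969, 4.1.9] -/
theorem rim_corePiece_apply_eq_zero {r : ℝ} (hr : r ∈ Ioo 0 r₀)
    (χ : 𝓓(cylinder (⊤ : Opens V), ℝ)) (ψ : TestForm (⊤ : Opens V) (2 * (q + 1)))
    (hψ : tsupport ⇑ψ ⊆ W.innerCore) :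
    ((T.corePiece b r W).boundary.prodInterval 0 1).pushforward ⊤ χ
        (contDiff_affineHomotopy contDiff_id W.contDiff_collapse) ψ = 0 := by
  set Q := (T.corePiece b r W).boundary with hQ
  have hH := contDiff_affineHomotopy (contDiff_id (𝕜 := ℝ) (E := V)) W.contDiff_collapse
  refine Current.apply_eq_zero_of_disjoint_support _ (Set.disjoint_left.2 fun x hxψ hxS => ?_)
  have hsub : ((Q.prodInterval 0 1).pushforward ⊤ χ hH).support ⊆ {y : V | ‖W.kf y‖ = W.a₃} := by
    refine ((Q.prodInterval 0 1).support_pushforward_subset χ hH).trans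
      (closure_minimal ?_ (isClosed_eq (continuous_norm.comp W.contDiff_kf.continuous)
        continuous_const))
    rintro _ ⟨p, ⟨-, hp⟩, rfl⟩
    have hp2 : p.2 ∈ Q.support := ((Q.support_prodInterval_subset 0 1) hp).2
    have := support_boundary_corePiece_subset T hΩ W hρ₀ hW htube hr hp2
    rw [mem_setOf_eq, W.kf_affineHomotopy_collapse]
    exact this
  have h1 : ‖W.kf x‖ = W.a₃ := hsub hxS
  have h2 : ‖W.kf x‖ < W.a₃ := (hψ hxψ).1
  exact absurd h1 h2.ne

include hΩ hKp hρ₀ hW htube in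
/-- **The homotopy formula over the window**: `c · [Γ] − P_r = ∂ S_r + rim`, where
`S_r = H_#([0,1] × P_r)` is the affine homotopy current from `id` to the collapse `h`,
`h_# P_r = c · [Γ]` (`collapse_pushforward_corePiece`) and `id_# P_r = P_r`.
[cite: Federer1969, 4.1.9, 4.3.18] -/
theorem smul_graphCurrent_sub_corePiece_eq {M : ℝ}
    (hM : ∀ k ∈ ball (0 : W.K) W.ρ, ‖fderiv ℂ W.Ψ k‖ ≤ M)
    (e : letI : InnerProductSpace ℝ W.K := InnerProductSpace.complexToReal
      OrthonormalBasis (Fin (2 * (q + 1))) ℝ W.K)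
    {c : ℤ} {r : ℝ} (hr : r ∈ Ioo 0 r₀) (hQr : (T.projPiece b r W hM).IsRepresentable)
    (hc : hQr.restrictSet W.slab W.isOpen_slab.measurableSet =
      currentOfIntegration (W.slab ∩ {x | x - W.m ∈ W.K}) (fun _ => c)
        (fun _ => fun i => ((e i : W.K) : V)))
    (ρ : 𝓓((⊤ : Opens ℝ), ℝ)) {Vρ : Set ℝ} (hVρ : IsOpen Vρ) (h01 : Icc (0 : ℝ) 1 ⊆ Vρ)
    (hρ : ∀ t ∈ Vρ, ρ t = 1) :
    letI : InnerProductSpace ℝ V := InnerProductSpace.complexToReal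
    (c : ℝ) • W.graphCurrent e 1 W.a₃ - T.corePiece b r W =
      (((T.corePiece b r W).prodInterval 0 1).pushforward ⊤
          (TestFunction.tensorCutoff ρ (W.cutoff hM))
          (contDiff_affineHomotopy contDiff_id W.contDiff_collapse)).boundary +
        ((T.corePiece b r W).boundary.prodInterval 0 1).pushforward ⊤
          (TestFunction.tensorCutoff ρ (W.cutoff hM))
          (contDiff_affineHomotopy contDiff_id W.contDiff_collapse) := by
  letI : InnerProductSpace ℝ V := InnerProductSpace.complexToReal
  have hsupp : (T.corePiece b r W).support ⊆ W.cutoffOne :=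
    support_corePiece_subset_cutoffOne T W (htube r hr)
  have h1 : ∀ x ∈ W.cutoffOne, W.cutoff hM x = 1 := fun x hx => W.cutoff_eq_one hM hx
  have hform := (T.corePiece b r W).homotopy_formula_affine (Ω' := (⊤ : Opens V)) (W.cutoff hM) ρ
    (contDiff_id (𝕜 := ℝ) (E := V)) W.contDiff_collapse W.isOpen_cutoffOne hsupp h1 hVρ h01 hρ
  rw [T.collapse_pushforward_corePiece hΩ W hKp hρ₀ hW htube hM e hr hQr hc,
    (T.corePiece b r W).pushforward_id (W.cutoff hM) W.isOpen_cutoffOne hsupp h1] at hform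
  exact hform

include hΩ hKp hρ₀ hW htube in
/-- **`c · [Γ](ψ) − P_r(ψ) = S_r(dψ)`** for every test form `ψ` supported in the inner core (the rim
term vanishes there). [cite: Federer1969, 4.1.9, 4.3.18] -/
theorem smul_graphCurrent_sub_corePiece_apply {M : ℝ}
    (hM : ∀ k ∈ ball (0 : W.K) W.ρ, ‖fderiv ℂ W.Ψ k‖ ≤ M)
    (e : letI : InnerProductSpace ℝ W.K := InnerProductSpace.complexToReal
      OrthonormalBasis (Fin (2 * (q + 1))) ℝ W.K)
    {c : ℤ} {r : ℝ} (hr : r ∈ Ioo 0 r₀) (hQr : (T.projPiece b r W hM).IsRepresentable)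
    (hc : hQr.restrictSet W.slab W.isOpen_slab.measurableSet =
      currentOfIntegration (W.slab ∩ {x | x - W.m ∈ W.K}) (fun _ => c)
        (fun _ => fun i => ((e i : W.K) : V)))
    (ρ : 𝓓((⊤ : Opens ℝ), ℝ)) {Vρ : Set ℝ} (hVρ : IsOpen Vρ) (h01 : Icc (0 : ℝ) 1 ⊆ Vρ)
    (hρ : ∀ t ∈ Vρ, ρ t = 1) (ψ : TestForm (⊤ : Opens V) (2 * (q + 1)))
    (hψ : tsupport ⇑ψ ⊆ W.innerCore) :
    letI : InnerProductSpace ℝ V := InnerProductSpace.complexToReal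
    (c : ℝ) * W.graphCurrent e 1 W.a₃ ψ - T.corePiece b r W ψ =
      ((T.corePiece b r W).prodInterval 0 1).pushforward ⊤
          (TestFunction.tensorCutoff ρ (W.cutoff hM))
          (contDiff_affineHomotopy contDiff_id W.contDiff_collapse) (TestForm.extDerivCLM ψ) := by
  letI : InnerProductSpace ℝ V := InnerProductSpace.complexToReal
  have h := T.smul_graphCurrent_sub_corePiece_eq hΩ W hKp hρ₀ hW htube hM e hr hQr hc ρ hVρ h01 hρ
  have h' := congrArg (fun S : Current (⊤ : Opens V) (2 * (q + 1)) => S ψ) h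
  simp only [sub_apply, add_apply, FunLike.coe_smul, Pi.smul_apply, smul_eq_mul] at h'
  rw [h', Current.boundary_apply,
    T.rim_corePiece_apply_eq_zero hΩ W hρ₀ hW htube hr _ ψ hψ, add_zero]

/-! ### The mass of the homotopy current -/

include hr₀ hΩ hρ₀ hW in
/-- **The core pieces have uniformly bounded mass**: `𝐌(P_r) ≤ C < ∞` for all `0 < r < r₁`
(mass formula + the uniform density bounds of `HolomorphicChainBlowUpPiece.lean`).
[cite: Harvey1977, §1.10; Federer1969, 4.1.28 (5)] -/
theorem exists_mass_corePiece_le :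
    ∃ C : ℝ≥0∞, C ≠ ⊤ ∧ ∃ r₁ : ℝ, 0 < r₁ ∧ r₁ ≤ r₀ ∧
      ∀ r ∈ Ioo 0 r₁, (T.corePiece b r W).mass ≤ C := by
  letI : InnerProductSpace ℝ V := InnerProductSpace.complexToReal
  have hR₁ : 0 < r₀ / 3 := by positivity
  have hball3 : ball b (3 * (r₀ / 3)) ⊆ (Ω : Set V) := by
    rw [show 3 * (r₀ / 3) = r₀ by ring]
    exact ball_subset_closedBall.trans hΩ
  obtain ⟨C, hC, hle⟩ := T.exists_lintegral_blowUpDensity_ball_le' hR₁ hball3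
  refine ⟨C * ENNReal.ofReal ((1 : ℝ) ^ (2 * (q + 1))), ENNReal.mul_ne_top hC ENNReal.ofReal_ne_top,
    r₀ / 6, by positivity, by linarith, fun r hr => ?_⟩
  have hr0 : r ∈ Ioo 0 r₀ := ⟨hr.1, by linarith [hr.2]⟩
  have hdata := T.isRectifiableData_blowUpPiece hr.1 (ball_subset_of_mem_Ioo hΩ hr0)
    W.isOpen_innerCore.measurableSet hρ₀ (innerCore_subset_closedBall W hW)
  have h1 : W.innerCore ⊆ ball (0 : V) 1 :=
    (innerCore_subset_closedBall W hW).trans (closedBall_subset_ball hρ₀)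
  calc (T.corePiece b r W).mass
      ≤ ∫⁻ x in T.blowUpSet b r ∩ W.innerCore, ‖(T.blowUpDensity b r x : ℝ)‖ₑ
          ∂(μHE[2 * (q + 1)] : Measure V) := hdata.mass_le
    _ ≤ ∫⁻ x in T.blowUpSet b r ∩ ball (0 : V) 1, ‖(T.blowUpDensity b r x : ℝ)‖ₑ
          ∂(μHE[2 * (q + 1)] : Measure V) :=
        lintegral_mono_set (inter_subset_inter_right _ h1)
    _ ≤ C * ENNReal.ofReal ((1 : ℝ) ^ (2 * (q + 1))) :=
        hle r hr.1 (by linarith [hr.2]) 0 (mem_closedBall_self zero_le_one) 1 one_pos le_rfl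

include hΩ hρ₀ hW htube in
/-- The support of the core piece is compact and, when the carrier is vertically `η`-close to the
graph in the tube, lies in `{‖k‖ ≤ a₃, ‖w‖ ≤ η}`. [folklore] -/
private theorem support_corePiece_subset_of_le {r : ℝ} (hr : r ∈ Ioo 0 r₀) {η : ℝ}
    (hη' : T.blowUpSet b r ∩ W.closedTube ⊆ {x | ‖W.wf x‖ < η}) :
    IsCompact (T.corePiece b r W).support ∧
      (T.corePiece b r W).support ⊆ {x | ‖W.kf x‖ ≤ W.a₃ ∧ ‖W.wf x‖ ≤ η} := by
  letI : InnerProductSpace ℝ V := InnerProductSpace.complexToReal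
  refine ⟨(isRectifiable_corePiece T hr.1 (ball_subset_of_mem_Ioo hΩ hr) W hρ₀ hW).2, ?_⟩
  have _ := htube
  refine (support_currentOfIntegration_subset_closure _ _ _).trans
    (closure_minimal ?_ (W.isClosed_sublevel (W.a₃_lt.trans (W.a₂_lt.trans W.a₁_lt))))
  rintro x ⟨hxW, hxI⟩
  have hxt : x ∈ W.closedTube :=
    W.tube_subset_closedTube (W.core_subset_tube (W.innerCore_subset_core hxI))
  exact ⟨hxI.1.le, (hη' ⟨hxW, hxt⟩).le⟩

include hΩ hρ₀ hW htube in
/-- **Mass of the homotopy current**: if the carrier is vertically `η`-close to the graph in the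
tube, then `𝐌(H_#([0,1] × P_r)) ≤ 2η (1 + t₀ (L₀ + 1))^{2p} 𝐌(P_r)`, where `L₀ = L₀(M)` is the
absolute derivative bound of the collapse (`ChartWindow.norm_fderiv_collapse_le`) and `|t| ≤ t₀`
on the support of the time cutoff `ρ`: the homotopy moves the points of `spt P_r` by
`‖h x − x‖ ≤ ‖w x‖ ≤ 2η` (the cutoff is adapted to `spt P_r`; the push-forward does not depend on
it). [cite: Federer1969, 4.1.9] -/
theorem mass_homotopy_corePiece_le {M : ℝ} (hM0 : 0 ≤ M)
    (hM : ∀ k ∈ ball (0 : W.K) W.ρ, ‖fderiv ℂ W.Ψ k‖ ≤ M)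
    (hτ : W.τ ≤ (W.a₁ ^ 2 - W.a₂ ^ 2) / (2 * W.ρ))
    (ρ : 𝓓((⊤ : Opens ℝ), ℝ)) (hρ1 : ∀ t, |ρ t| ≤ 1) {t₀ : ℝ} (ht₀0 : 0 ≤ t₀)
    (ht₀ : ∀ t ∈ tsupport ⇑ρ, |t| ≤ t₀) {r : ℝ} (hr : r ∈ Ioo 0 r₀) {η : ℝ} (hη : 0 < η)
    (hη' : T.blowUpSet b r ∩ W.closedTube ⊆ {x | ‖W.wf x‖ < η}) :
    (((T.corePiece b r W).prodInterval 0 1).pushforward ⊤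
        (TestFunction.tensorCutoff ρ (W.cutoff hM))
        (contDiff_affineHomotopy contDiff_id W.contDiff_collapse)).mass ≤
      ENNReal.ofReal (2 * η * (1 + t₀ * (collapseLipConst M + 1)) ^ (2 * (q + 1))) *
        (T.corePiece b r W).mass := by
  letI : InnerProductSpace ℝ V := InnerProductSpace.complexToReal
  set P := T.corePiece b r W with hP
  have hH := contDiff_affineHomotopy (contDiff_id (𝕜 := ℝ) (E := V)) W.contDiff_collapse
  obtain ⟨hKc, hKs⟩ := support_corePiece_subset_of_le T hΩ W hρ₀ hW htube hr hη'
  have hK1 : P.support ⊆ W.cutoffOne := support_corePiece_subset_cutoffOne T W (htube r hr)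
  -- an adapted cutoff
  set N : Set V := W.cutoffOne ∩ {x | ‖W.kf x‖ < W.a₂ ∧ ‖W.wf x‖ < 2 * η} with hN
  have hNo : IsOpen N :=
    W.isOpen_cutoffOne.inter (W.isOpen_norm_kf_lt_inter_norm_wf_lt (W.a₂_lt.trans W.a₁_lt).le)
  have hKN : P.support ⊆ N := fun x hx => by
    obtain ⟨hk, hw⟩ := hKs hx
    exact ⟨hK1 hx, lt_of_le_of_lt hk W.a₃_lt, by linarith⟩
  obtain ⟨χ', U', hU'o, hKU', hχ'1, hχ'abs, hχ'N⟩ :=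
    exists_cutoff_subset (Ω := (⊤ : Opens V)) hKc hNo (subset_univ _) hKN
  -- the push-forward does not depend on the cutoff
  have hcongr : (P.prodInterval 0 1).pushforward ⊤ (TestFunction.tensorCutoff ρ (W.cutoff hM)) hH =
      (P.prodInterval 0 1).pushforward ⊤ (TestFunction.tensorCutoff ρ χ') hH := by
    refine (P.prodInterval 0 1).pushforward_congr_cutoff hH (U := univ ×ˢ (W.cutoffOne ∩ U'))
      (isOpen_univ.prod (W.isOpen_cutoffOne.inter hU'o))
      ((P.support_prodInterval_subset 0 1).trans (prod_mono (subset_univ _)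
        (subset_inter hK1 hKU'))) fun p hp => ?_
    rw [TestFunction.tensorCutoff_apply, TestFunction.tensorCutoff_apply,
      W.cutoff_eq_one hM hp.2.1, hχ'1 _ hp.2.2]
  rw [hcongr]
  -- Federer's mass estimate for the affine homotopy
  set A : ℝ := 1 + t₀ * (collapseLipConst M + 1) with hA
  have hL0 : 0 ≤ collapseLipConst M :=
    (norm_nonneg _).trans (W.norm_fderiv_collapse_le hM0 hM hτ 0)
  have hA1 : 1 ≤ A := by rw [hA]; nlinarith
  have hA0 : 0 ≤ A := zero_le_one.trans hA1
  refine P.mass_affineHomotopy_le χ' ρ contDiff_id W.contDiff_collapse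
    (mul_nonneg (mul_nonneg zero_le_two hη.le) (pow_nonneg hA0 _)) hρ1 fun t ht x hx => ?_
  have hxN : x ∈ N := hχ'N hx
  have h1 : |χ' x| ≤ 1 := hχ'abs x
  have h2 : ‖W.collapse x - id x‖ ≤ 2 * η :=
    (W.norm_collapse_sub_le_norm_wf x).trans hxN.2.2.le
  have h3 : ‖fderiv ℝ id x + t • (fderiv ℝ W.collapse x - fderiv ℝ id x)‖ ≤ A := by
    rw [fderiv_id]
    calc ‖ContinuousLinearMap.id ℝ V + t • (fderiv ℝ W.collapse x - ContinuousLinearMap.id ℝ V)‖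
        ≤ ‖ContinuousLinearMap.id ℝ V‖ + ‖t • (fderiv ℝ W.collapse x - ContinuousLinearMap.id ℝ V)‖ :=
          norm_add_le _ _
      _ ≤ 1 + |t| * (‖fderiv ℝ W.collapse x‖ + ‖ContinuousLinearMap.id ℝ V‖) := by
          rw [norm_smul, Real.norm_eq_abs]
          gcongr
          · exact ContinuousLinearMap.norm_id_le
          · exact norm_sub_le _ _
      _ ≤ 1 + t₀ * (collapseLipConst M + 1) := by
          gcongr
          · exact ht₀ t ht
          · exact W.norm_fderiv_collapse_le hM0 hM hτ x
          · exact ContinuousLinearMap.norm_id_le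
  calc |χ' x| * ‖W.collapse x - id x‖ *
        ‖fderiv ℝ id x + t • (fderiv ℝ W.collapse x - fderiv ℝ id x)‖ ^ (2 * (q + 1))
      ≤ 1 * (2 * η) * A ^ (2 * (q + 1)) := by gcongr
    _ = 2 * η * A ^ (2 * (q + 1)) := by ring

/-! ### Weak convergence over the core -/

include hr₀ hΩ hKp hρ₀ hW htube in
/-- **The blow-ups converge weakly to `c` times the graph over the core of the window**: if the
pulled-back carriers are eventually vertically `η`-close to the graph in the tube for EVERY `η > 0`
(the windows of the tangent cone), then for every test form `ψ` supported in the inner core,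
`P_r(ψ) → c · [Γ](ψ)` as `r → 0⁺` (full limit), `c` the sheet number of the window.
[cite: Federer1969, 4.1.9, 4.3.18; Harvey1977, Thm. 1.31] -/
theorem tendsto_corePiece_apply {M : ℝ} (hM0 : 0 ≤ M)
    (hM : ∀ k ∈ ball (0 : W.K) W.ρ, ‖fderiv ℂ W.Ψ k‖ ≤ M)
    (hτ : W.τ ≤ (W.a₁ ^ 2 - W.a₂ ^ 2) / (2 * W.ρ))
    (e : letI : InnerProductSpace ℝ W.K := InnerProductSpace.complexToReal
      OrthonormalBasis (Fin (2 * (q + 1))) ℝ W.K)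
    {c : ℤ} (hsheet : ∀ r ∈ Ioo 0 r₀, ∃ hQr : (T.projPiece b r W hM).IsRepresentable,
      hQr.restrictSet W.slab W.isOpen_slab.measurableSet =
        currentOfIntegration (W.slab ∩ {x | x - W.m ∈ W.K}) (fun _ => c)
          (fun _ => fun i => ((e i : W.K) : V)))
    (hfine : ∀ η : ℝ, 0 < η →
      ∀ᶠ r in 𝓝[>] (0 : ℝ), T.blowUpSet b r ∩ W.closedTube ⊆ {x | ‖W.wf x‖ < η})
    (ψ : TestForm (⊤ : Opens V) (2 * (q + 1))) (hψ : tsupport ⇑ψ ⊆ W.innerCore) :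
    letI : InnerProductSpace ℝ V := InnerProductSpace.complexToReal
    Tendsto (fun r => T.corePiece b r W ψ) (𝓝[>] (0 : ℝ))
      (𝓝 ((c : ℝ) * W.graphCurrent e 1 W.a₃ ψ)) := by
  letI : InnerProductSpace ℝ V := InnerProductSpace.complexToReal
  -- a time cutoff `ρ = 1` near `[0, 1]`, `0 ≤ ρ ≤ 1`, and a bound `|t| ≤ t₀` on its support
  obtain ⟨ρ, Vρ, hVρo, h01, hρV1, hρ01⟩ := exists_testFunction_eq_one_nhds
    (Ω := (⊤ : Opens ℝ)) isCompact_Icc (subset_univ (Icc (0 : ℝ) 1))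
  have hρ1 : ∀ t, |ρ t| ≤ 1 := fun t => by
    have := hρ01 t
    rw [abs_le]; constructor <;> linarith [this.1, this.2]
  obtain ⟨t₁, ht₁⟩ := (ρ.hasCompactSupport.isCompact.isBounded).subset_closedBall (0 : ℝ)
  set t₀ : ℝ := max t₁ 0 with ht₀def
  have ht₀0 : 0 ≤ t₀ := le_max_right _ _
  have ht₀ : ∀ t ∈ tsupport ⇑ρ, |t| ≤ t₀ := fun t ht => by
    have := ht₁ ht
    rw [mem_closedBall, dist_zero_right, Real.norm_eq_abs] at this
    exact this.trans (le_max_left _ _)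
  -- a bound on `dψ`
  obtain ⟨Cd, hCd⟩ := (TestForm.extDerivCLM ψ).hasCompactSupport.exists_bound_of_continuous
    (TestForm.extDerivCLM ψ).contDiff.continuous
  set Cd' : ℝ := max Cd 0 + 1 with hCd'
  have hCd'0 : 0 < Cd' := by rw [hCd']; positivity
  have hCd'' : ∀ x, ‖TestForm.extDerivCLM ψ x‖ ≤ Cd' := fun x =>
    (hCd x).trans ((le_max_left _ _).trans (le_add_of_nonneg_right zero_le_one))
  -- the uniform mass bound
  obtain ⟨C, hC, r₁, hr₁, hr₁r₀, hmass⟩ := T.exists_mass_corePiece_le hr₀ hΩ W hρ₀ hW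
  set A : ℝ := (1 + t₀ * (collapseLipConst M + 1)) ^ (2 * (q + 1)) with hA
  have hL0 : 0 ≤ collapseLipConst M :=
    (norm_nonneg _).trans (W.norm_fderiv_collapse_le hM0 hM hτ 0)
  have hA0 : 0 ≤ A := by
    rw [hA]
    exact pow_nonneg (add_nonneg zero_le_one (mul_nonneg ht₀0 (by linarith))) _
  set K₀ : ℝ := Cd' * (2 * A * C.toReal) with hK₀
  have hK₀0 : 0 ≤ K₀ := by
    rw [hK₀]
    exact mul_nonneg hCd'0.le (mul_nonneg (mul_nonneg zero_le_two hA0) ENNReal.toReal_nonneg)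
  rw [Metric.tendsto_nhds]
  intro ε hε
  set η : ℝ := ε / (K₀ + 1) with hη
  have hη0 : 0 < η := by rw [hη]; exact div_pos hε (by linarith)
  have hηK : η * K₀ < ε := by
    rw [hη, div_mul_eq_mul_div, div_lt_iff₀ (by positivity)]
    nlinarith
  have hIoo : Ioo (0 : ℝ) r₁ ∈ 𝓝[>] (0 : ℝ) := Ioo_mem_nhdsGT hr₁
  filter_upwards [hIoo, hfine η hη0] with r hr hrη
  have hr0 : r ∈ Ioo 0 r₀ := ⟨hr.1, hr.2.trans_le hr₁r₀⟩
  obtain ⟨hQr, hc⟩ := hsheet r hr0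
  -- `c [Γ](ψ) − P_r(ψ) = S_r(dψ)`
  have hid := T.smul_graphCurrent_sub_corePiece_apply hΩ W hKp hρ₀ hW htube hM e hr0 hQr hc ρ hVρo
    h01 hρV1 ψ hψ
  set S := ((T.corePiece b r W).prodInterval 0 1).pushforward ⊤
    (TestFunction.tensorCutoff ρ (W.cutoff hM))
    (contDiff_affineHomotopy contDiff_id W.contDiff_collapse) with hS
  have hSmass : S.mass ≤ ENNReal.ofReal (2 * η * (1 + t₀ * (collapseLipConst M + 1)) ^
      (2 * (q + 1))) * (T.corePiece b r W).mass :=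
    T.mass_homotopy_corePiece_le hΩ W hρ₀ hW htube hM0 hM hτ ρ hρ1 ht₀0 ht₀ hr0 hη0 hrη
  have hPmass : (T.corePiece b r W).mass ≤ C := hmass r hr
  have hSle : S.mass ≤ ENNReal.ofReal (2 * η * A) * C := by
    refine hSmass.trans ?_
    rw [hA]
    gcongr
  have hStop : S.mass ≠ ⊤ := ne_top_of_le_ne_top (ENNReal.mul_ne_top ENNReal.ofReal_ne_top hC) hSle
  have hSreal : S.mass.toReal ≤ 2 * η * A * C.toReal := by
    have := ENNReal.toReal_mono (ENNReal.mul_ne_top ENNReal.ofReal_ne_top hC) hSle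
    rwa [ENNReal.toReal_mul, ENNReal.toReal_ofReal
      (mul_nonneg (mul_nonneg zero_le_two hη0.le) hA0)] at this
  have habs : |S (TestForm.extDerivCLM ψ)| ≤ Cd' * S.mass.toReal :=
    abs_apply_le_mul_mass S hStop hCd'0 hCd''
  rw [Real.dist_eq]
  calc |T.corePiece b r W ψ - (c : ℝ) * W.graphCurrent e 1 W.a₃ ψ|
      = |S (TestForm.extDerivCLM ψ)| := by rw [abs_sub_comm, hid]
    _ ≤ Cd' * S.mass.toReal := habs
    _ ≤ Cd' * (2 * η * A * C.toReal) := by gcongr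
    _ = η * K₀ := by rw [hK₀]; ring
    _ < ε := hηK

include hr₀ hΩ hKp hρ₀ hW htube in
/-- **The blow-ups `D_r` converge weakly to `c · [Γ]` over the core of the window** — the form of
`tendsto_corePiece_apply` for test forms on the unit ball: for `ψ ∈ 𝒟^{2p}(B(0,1))` supported in the
inner core, `D_r(ψ) → c · [Γ](ψ)` as `r → 0⁺` (`D_r(ψ) = P_r(ψ)`, `blowUp_apply_eq_blowUpPiece`).
[cite: Federer1969, 4.3.18; Harvey1977, Thm. 1.31] -/
theorem tendsto_blowUp_apply_of_tsupport_subset_innerCore {M : ℝ} (hM0 : 0 ≤ M)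
    (hM : ∀ k ∈ ball (0 : W.K) W.ρ, ‖fderiv ℂ W.Ψ k‖ ≤ M)
    (hτ : W.τ ≤ (W.a₁ ^ 2 - W.a₂ ^ 2) / (2 * W.ρ))
    (e : letI : InnerProductSpace ℝ W.K := InnerProductSpace.complexToReal
      OrthonormalBasis (Fin (2 * (q + 1))) ℝ W.K)
    {c : ℤ} (hsheet : ∀ r ∈ Ioo 0 r₀, ∃ hQr : (T.projPiece b r W hM).IsRepresentable,
      hQr.restrictSet W.slab W.isOpen_slab.measurableSet =
        currentOfIntegration (W.slab ∩ {x | x - W.m ∈ W.K}) (fun _ => c)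
          (fun _ => fun i => ((e i : W.K) : V)))
    (hfine : ∀ η : ℝ, 0 < η →
      ∀ᶠ r in 𝓝[>] (0 : ℝ), T.blowUpSet b r ∩ W.closedTube ⊆ {x | ‖W.wf x‖ < η})
    (ψ : TestForm (unitBall V) (2 * (q + 1))) (hψ : tsupport ⇑ψ ⊆ W.innerCore) :
    letI : InnerProductSpace ℝ V := InnerProductSpace.complexToReal
    Tendsto (fun r => T.blowUp b r ψ) (𝓝[>] (0 : ℝ))
      (𝓝 ((c : ℝ) * W.graphCurrent e 1 W.a₃ (TestFunction.monoCLM ℝ ψ))) := by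
  letI : InnerProductSpace ℝ V := InnerProductSpace.complexToReal
  have hle : unitBall V ≤ (⊤ : Opens V) := le_top
  have hψ' : tsupport ⇑(TestFunction.monoCLM ℝ ψ : TestForm (⊤ : Opens V) (2 * (q + 1))) ⊆
      W.innerCore := by
    rw [TestForm.monoCLM_apply_of_le hle]; exact hψ
  have h := T.tendsto_corePiece_apply hr₀ hΩ W hKp hρ₀ hW htube hM0 hM hτ e hsheet hfine _ hψ'
  have hr₀' : Ioo (0 : ℝ) r₀ ∈ 𝓝[>] (0 : ℝ) := Ioo_mem_nhdsGT hr₀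
  refine h.congr' ?_
  filter_upwards [hr₀'] with r hr
  rw [T.blowUp_apply_eq_blowUpPiece hr.1 (ball_subset_of_mem_Ioo hΩ hr)
    W.isOpen_innerCore.measurableSet hρ₀ (innerCore_subset_closedBall W hW) ψ hψ]
  rfl

end HolomorphicChain

end Literature.Geometry.Kaehler
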